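import Literature.NumberTheory.Automorphic.RankinSelbergTorusIntegral
import Literature.NumberTheory.Automorphic.ReductionTheoryGLnMinkowski
import Literature.NumberTheory.Automorphic.IwasawaDecompositionAdelic
import Literature.NumberTheory.Automorphic.MultipliableLGL2
import Literature.NumberTheory.GaloisRepresentations.UnitIdeles
import HarnessLib

/-!
# Positivity of the unit-box Rankin–Selberg integral from one non-vanishing value of `W`

Topic `NumberTheory/Automorphic`; namespace `Literature.NumberTheory.Automorphic`. Proof file
(theorems only: no definition, no named fact), a brick of the real-point Rankin–Selberg programme
behind Jacquet–Shalika (1981), Lemma (5.2) / Thm. (5.3) (`JacquetShalika1981_schurSelfSum_prod_bounded`,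
`multipliable_partialStandardL`, …). The Euler lower bound of `RankinSelbergTorusIntegral`
(`exists_prod_schurSelfSum_le_of_rankinSelbergTorusIntegral_ne_top`,
`exists_prod_schurSelfSum_le_of_cuspidal`) bounds the partial products `∏_{v ∈ F} T_v(q_v^{-σ})` by
`Ψ(σ) / c` and needs, besides `Ψ(σ) < ∞`, the **positivity** of the unit-box integral

  `c = ∫_{B(Good) × K} |W(diag(a) k)|² Φ(e_n diag(a) k) |det a|^σ δ_B(a)⁻¹ dνA dνK`

(hypothesis `hpos` there). In print this is "`W_φ(g₀) ≠ 0` for some `g₀` (cusp forms are generic)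
and the integrand is continuous and non-negative" (Jacquet–Shalika (1981), §4, (4.5)–(4.6) and the
remark after Prop. (2.3) that the local integrals at the remaining places are entire and not
identically zero; Cogdell (2004), §2.3, proof of Thm. 2.2: `Ψ(s; W_φ, W_φ', Φ) ≢ 0` for a suitable
choice of data). This file proves the soft form of that step which the tree's assembly needs:

* `continuous_torusPoint`, `continuous_lastRow`, `continuous_torusWeight`, `torusWeight_pos` —
  continuity of the torus coordinates `(a, k) ↦ diag(a) k`, of the last row and
  of the weight `|det a|^σ δ_B(a)⁻¹ = ∏ ‖aᵢ‖^{σ-(n-1-2i)}`, and its positivity;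
* `setLIntegral_torusIntegrand_unitBox_ne_zero` (**main**): let `W : GL_n(𝔸_K) → ℂ` be continuous
  with `W(diag(a₀) k₀) ≠ 0` at a base point whose torus coordinate `a₀` has unit entries at every
  place of `Good` (`a₀ ∈ unitBox Good`) and whose last entry `a₀,ₙ₋₁` is integral at every finite
  place; let `Φ = Φ_∞ ⊗ 𝟙_{𝒪̂ⁿ}` (`standardTestFun`) with `Φ_∞` continuous and positive, and let the
  measures `νA`, `νK` be positive on open sets (Haar measures). Then
  `∫_{unitBox Good × K} torusIntegrand W Φ σ ≠ 0`. Proof: on the open box `a ∈ a₀ · (𝕌_K)ⁿ`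
  (`unitIdeles`, units at all finite places; `isOpen_unitIdeles`) every `a` lies in `unitBox Good`
  and `e_n diag(a) k = a_{n-1} e_n k` stays integral (`lastRow_glDiagonal_mul`,
  `valued_lastRow_torusPoint_le_one`), so there the integrand is the continuous function
  `|W(diag(a) k)|² Φ_∞((e_n diag(a) k)_∞) · (weight)`, positive at `(a₀, k₀)`; it is `≥ c/2` on an
  open box `∏ᵢ Uᵢ × O₂ ∋ (a₀, k₀)`, which has positive `νA ⊗ νK`-measure.

* `exists_torusPoint_apply_ne_zero`, `finite_setOf_exists_valued_ne_one`,
  `mem_unitBox_setOf_forall`, `exists_ne_zero_valued_algebraMap_mul_le_one` — the base-point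
  bookkeeping: a torus point `diag(a) k` with `W ≠ 0` from any `g₀` with `W(g₀) ≠ 0` (Iwasawa
  decomposition, `‖W(u g)‖ = ‖W(g)‖`), finiteness of the set of places where `a` is not a unit, and a
  global integer clearing the denominators of an idele.

In the assembly the base point comes from genericity (`W_φ ≢ 0`, `WhittakerTowerBridge` /
`CuspidalTowerGeneric`), the Iwasawa decomposition and the `N_n(𝔸_K)`-equivariance of `W_φ`
(`W(u a k) = ψ(u) W(a k)`), the finitely many places where `a₀` is not a unit being put into the
exceptional set `S₀` of `JacquetShalika1981_schurSelfSum_prod_bounded`, and the integrality of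
`a₀,ₙ₋₁` being arranged by a central rational scalar (`W(ξ g) = W(g)`, `ξ ∈ Kˣ`). Everything here is
proved; folklore.

## References

* H. Jacquet, J. A. Shalika, *On Euler products and the classification of automorphic
  representations I*, Amer. J. Math. 103 (1981), §2 Prop. (2.3), §4 [JacquetShalikaAJM1981].
* J. W. Cogdell, *Analytic theory of L-functions for GL_n*, in: J. Bernstein, S. Gelbart (eds.),
  *An Introduction to the Langlands Program*, Birkhäuser (2004), §2.3, Thm. 2.2
  [CogdellAnalyticTheory2004].
-/

noncomputable section

open MeasureTheory Measure NumberField IsDedekindDomain Matrix Set Filter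
open scoped MatrixGroups ENNReal NNReal Pointwise Topology
open Literature.NumberTheory.GaloisRepresentations (ideleGroup unitIdeles isOpen_unitIdeles
  mem_unitIdeles_iff)

namespace Literature.NumberTheory.Automorphic

/-! ### Continuity of the torus coordinates and of the weight -/

section Continuity

variable {n : ℕ} {K : Type} [Field K] [NumberField K]

/-- The torus coordinates `(a, k) ↦ diag(a) k ∈ GL_n(𝔸_K)` are continuous. [folklore] -/
theorem continuous_torusPoint : Continuous (torusPoint n K) := by
  unfold torusPoint
  exact ((continuous_glDiagonal (n := n) (AdeleRing (𝓞 K) K)).comp continuous_fst).mul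
    (continuous_subtype_val.comp continuous_snd)

/-- The last row `g ↦ e_n g` is continuous. [folklore] -/
theorem continuous_lastRow : Continuous (lastRow n K) := by
  unfold lastRow
  exact continuous_const.matrix_vecMul Units.continuous_val

variable (K) in
/-- The idelic norm of an idele is positive. [folklore] -/
theorem ideleNorm_coe_pos (x : ideleGroup K) : 0 < ((IdeleClassGroup.ideleNorm K x : ℝ≥0) : ℝ) :=
  NNReal.coe_pos.2 (pos_iff_ne_zero.2 (ideleNorm_ne_zero x))

/-- The torus weight `∏ᵢ ‖aᵢ‖^{σ - (n-1-2i)}` is continuous (`continuous_ideleNorm_holds`; real powers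
of positive reals). [folklore] -/
theorem continuous_torusWeight (σ : ℝ) : Continuous (torusWeight n K σ) := by
  unfold torusWeight
  refine continuous_finsetProd _ fun i _ => ?_
  have hc : Continuous fun a : Fin n → ideleGroup K =>
      ((IdeleClassGroup.ideleNorm K (a i) : ℝ≥0) : ℝ) :=
    NNReal.continuous_coe.comp ((continuous_ideleNorm_holds K).comp (continuous_apply i))
  exact hc.rpow_const fun a => Or.inl (ideleNorm_coe_pos K (a i)).ne'

/-- The torus weight is positive. [folklore] -/
theorem torusWeight_pos (σ : ℝ) (a : Fin n → ideleGroup K) : 0 < torusWeight n K σ a :=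
  Finset.prod_pos fun i _ => Real.rpow_pos_of_pos (ideleNorm_coe_pos K (a i)) _

/-- The last entry is multiplicative. [folklore] -/
theorem lastEntry_mul (t a : Fin n → ideleGroup K) : lastEntry (t * a) = lastEntry t * lastEntry a := by
  unfold lastEntry
  split_ifs
  · rfl
  · exact (mul_one _).symm

end Continuity

/-! ### Positivity of the unit-box integral -/

section Positivity

variable {n : ℕ} {K : Type} [Field K] [NumberField K]

attribute [local instance] adelicBorel borelSpace_adelic locallyCompactSpace_adelic
  secondCountableTopology_gl_adelic

/-- **Positivity of the unit-box Rankin–Selberg integral.** Let `W : GL_n(𝔸_K) → ℂ` be continuous and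
non-zero at a torus point `diag(a₀) k₀` with `a₀ ∈ unitBox Good` (unit entries at the places of
`Good`) and `a₀,ₙ₋₁` integral at every finite place (`lastEntry a₀`), let `Φ_∞` be continuous and
positive, and let `νA`, `νK` be s-finite measures positive on non-empty open sets. Then the integral
of the Rankin–Selberg integrand `|W(diag(a) k)|² Φ(e_n diag(a) k) |det a|^σ δ_B(a)⁻¹`,
`Φ = Φ_∞ ⊗ 𝟙_{𝒪̂ⁿ}` (`standardTestFun`), over `unitBox Good × K` is non-zero — the hypothesis `hpos`
of `exists_prod_schurSelfSum_le_of_rankinSelbergTorusIntegral_ne_top` /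
`exists_prod_schurSelfSum_le_of_cuspidal` (`RankinSelbergTorusIntegral`). [folklore] -/
theorem setLIntegral_torusIntegrand_unitBox_ne_zero
    [MeasurableSpace (ideleGroup K)] [BorelSpace (ideleGroup K)]
    {W : GL (Fin n) (AdeleRing (𝓞 K) K) → ℂ} (hW : Continuous W)
    {a₀ : Fin n → ideleGroup K} {k₀ : ↥(maximalCompactAdelic n K)}
    (hW0 : W (torusPoint n K (a₀, k₀)) ≠ 0)
    {Good : Set (HeightOneSpectrum (𝓞 K))} (ha₀ : a₀ ∈ unitBox Good)
    (hint : ∀ w : HeightOneSpectrum (𝓞 K),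
      Valued.v (((lastEntry a₀ : ideleGroup K) : AdeleRing (𝓞 K) K).2 w) ≤ 1)
    {Φinf : (Fin n → InfiniteAdeleRing K) → ℝ} (hΦc : Continuous Φinf) (hΦ : ∀ z, 0 < Φinf z)
    (σ : ℝ) (νA : Measure (Fin n → ideleGroup K)) [SFinite νA] [νA.IsOpenPosMeasure]
    (νK : Measure ↥(maximalCompactAdelic n K)) [SFinite νK] [νK.IsOpenPosMeasure] :
    ∫⁻ p in unitBox Good ×ˢ Set.univ, torusIntegrand n K W (standardTestFun n K Φinf) σ p
      ∂(νA.prod νK) ≠ 0 := by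
  classical
  -- the continuous function which agrees with the integrand where the last row is integral
  set G : (Fin n → ideleGroup K) × ↥(maximalCompactAdelic n K) → ℝ := fun p =>
    ‖W (torusPoint n K p)‖ ^ 2 * Φinf (fun i => (lastRow n K (torusPoint n K p) i).1) *
      torusWeight n K σ p.1 with hG
  have hGc : Continuous G := by
    refine ((continuous_norm.comp (hW.comp continuous_torusPoint)).pow 2).mul ?_ |>.mul
      ((continuous_torusWeight σ).comp continuous_fst)
    exact hΦc.comp (continuous_pi fun i => continuous_fst.comp
      ((continuous_apply i).comp (continuous_lastRow.comp continuous_torusPoint)))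
  have hG0 : 0 < G (a₀, k₀) :=
    mul_pos (mul_pos (pow_pos (norm_pos_iff.2 hW0) 2) (hΦ _)) (torusWeight_pos σ a₀)
  -- the open box of unit multiples of `a₀`
  set B : Set (Fin n → ideleGroup K) := {a | ∀ i, (a₀ i)⁻¹ * a i ∈ unitIdeles K} with hB
  have hBo : IsOpen B := by
    have hB' : B = (fun a : Fin n → ideleGroup K => a₀⁻¹ * a) ⁻¹'
        Set.pi Set.univ (fun _ => (unitIdeles K : Set (ideleGroup K))) := by
      ext a
      simp only [hB, Set.mem_setOf_eq, Set.mem_preimage, Set.mem_univ_pi, Pi.mul_apply,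
        Pi.inv_apply, SetLike.mem_coe]
    rw [hB']
    exact (isOpen_set_pi Set.finite_univ fun _ _ => isOpen_unitIdeles K).preimage
      (continuous_const.mul continuous_id)
  have ha₀B : a₀ ∈ B := fun i => by
    rw [inv_mul_cancel]
    exact (unitIdeles K).one_mem
  -- on `B`: membership in the unit box …
  have hBunit : ∀ a ∈ B, a ∈ unitBox Good := by
    intro a ha w hw i
    have he : a i = a₀ i * ((a₀ i)⁻¹ * a i) := by rw [mul_inv_cancel_left]
    rw [he, ideleGroup_snd_mul_apply, map_mul, ha₀ w hw i, mem_unitIdeles_iff.1 (ha i) w, one_mul]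
  -- … and integrality of the last row `e_n diag(a) k = a_{n-1} • e_n k`
  have hone : ∀ (k : ↥(maximalCompactAdelic n K)) (i : Fin n) (w : HeightOneSpectrum (𝓞 K)),
      Valued.v ((lastRow n K (torusPoint n K (1, k)) i).2 w) ≤ 1 := fun k i w =>
    valued_lastRow_torusPoint_le_one (v := w) (a := 1) (fun j => by
      rw [Pi.one_apply]
      exact (congrArg Valued.v (show (((1 : ideleGroup K) : AdeleRing (𝓞 K) K).2 w) = 1 from rfl)).trans
        (map_one _)) k i
  have hlastB : ∀ a ∈ B, ∀ w : HeightOneSpectrum (𝓞 K),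
      Valued.v (((lastEntry a : ideleGroup K) : AdeleRing (𝓞 K) K).2 w) ≤ 1 := by
    intro a ha w
    have he : a = a₀ * (a₀⁻¹ * a) := by rw [mul_inv_cancel_left]
    have hu : lastEntry (a₀⁻¹ * a) ∈ unitIdeles K := by
      unfold lastEntry
      split_ifs with h
      · exact ha _
      · exact (unitIdeles K).one_mem
    rw [he, lastEntry_mul, ideleGroup_snd_mul_apply, map_mul, mem_unitIdeles_iff.1 hu w, mul_one]
    exact hint w
  have hBint : ∀ a ∈ B, ∀ (k : ↥(maximalCompactAdelic n K)) (i : Fin n) (w : HeightOneSpectrum (𝓞 K)),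
      (lastRow n K (torusPoint n K (a, k)) i).2 w ∈ w.adicCompletionIntegers K := by
    intro a ha k i w
    rw [HeightOneSpectrum.mem_adicCompletionIntegers]
    have he : torusPoint n K (a, k) = glDiagonal n (AdeleRing (𝓞 K) K) a * torusPoint n K (1, k) := by
      rw [← torusPoint_mul, mul_one]
    rw [he, lastRow_glDiagonal_mul, Pi.smul_apply, smul_eq_mul]
    change Valued.v ((((lastEntry a : ideleGroup K) : AdeleRing (𝓞 K) K).2 w) *
      ((lastRow n K (torusPoint n K (1, k)) i).2 w)) ≤ 1
    rw [map_mul]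
    exact mul_le_one' (hlastB a ha w) (hone k i w)
  -- there the integrand is `ofReal ∘ G`
  have hBeq : ∀ a ∈ B, ∀ k : ↥(maximalCompactAdelic n K),
      torusIntegrand n K W (standardTestFun n K Φinf) σ (a, k) = ENNReal.ofReal (G (a, k)) := by
    intro a ha k
    simp only [torusIntegrand, standardTestFun, hG]
    rw [if_pos (hBint a ha k)]
  -- the open set where `G > G₀ / 2`, and an open measurable box inside it
  set O : Set ((Fin n → ideleGroup K) × ↥(maximalCompactAdelic n K)) :=
    {p | G (a₀, k₀) / 2 < G p} ∩ B ×ˢ Set.univ with hO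
  have hOo : IsOpen O := (isOpen_lt continuous_const hGc).inter (hBo.prod isOpen_univ)
  have hO0 : (a₀, k₀) ∈ O := ⟨by simp only [Set.mem_setOf_eq]; linarith, ha₀B, Set.mem_univ _⟩
  obtain ⟨O₁, O₂, hO₁o, hO₂o, ha₀O₁, hk₀O₂, hsub⟩ := isOpen_prod_iff.1 hOo a₀ k₀ hO0
  obtain ⟨I, u, hu, hIsub⟩ := isOpen_pi_iff.1 hO₁o a₀ ha₀O₁
  set T : Set ((Fin n → ideleGroup K) × ↥(maximalCompactAdelic n K)) :=
    (↑I : Set (Fin n)).pi u ×ˢ O₂ with hT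
  have hTm : MeasurableSet T :=
    (MeasurableSet.pi I.countable_toSet fun i hi => (hu i hi).1.measurableSet).prod hO₂o.measurableSet
  have hTO : T ⊆ O := fun p hp => hsub ⟨hIsub hp.1, hp.2⟩
  have hTsub : T ⊆ unitBox Good ×ˢ Set.univ := fun p hp =>
    ⟨hBunit p.1 (hTO hp).2.1, Set.mem_univ _⟩
  have hTpos : 0 < (νA.prod νK) T := by
    rw [hT, Measure.prod_prod]
    refine ENNReal.mul_pos ?_ ?_
    · exact ((isOpen_set_pi I.finite_toSet fun i hi => (hu i hi).1).measure_pos νA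
        ⟨a₀, fun i hi => (hu i hi).2⟩).ne'
    · exact (hO₂o.measure_pos νK ⟨k₀, hk₀O₂⟩).ne'
  -- the lower bound on `T`
  have hlow : ∀ p ∈ T, ENNReal.ofReal (G (a₀, k₀) / 2) ≤
      torusIntegrand n K W (standardTestFun n K Φinf) σ p := by
    rintro ⟨a, k⟩ hp
    have hpO : (a, k) ∈ O := hTO hp
    rw [hBeq a hpO.2.1 k]
    exact ENNReal.ofReal_le_ofReal (le_of_lt hpO.1)
  intro h0
  have hle : ENNReal.ofReal (G (a₀, k₀) / 2) * (νA.prod νK) T ≤ 0 :=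
    calc ENNReal.ofReal (G (a₀, k₀) / 2) * (νA.prod νK) T
        = ∫⁻ _ in T, ENNReal.ofReal (G (a₀, k₀) / 2) ∂(νA.prod νK) := (setLIntegral_const _ _).symm
      _ ≤ ∫⁻ p in T, torusIntegrand n K W (standardTestFun n K Φinf) σ p ∂(νA.prod νK) :=
          setLIntegral_mono' hTm hlow
      _ ≤ ∫⁻ p in unitBox Good ×ˢ Set.univ, torusIntegrand n K W (standardTestFun n K Φinf) σ p
            ∂(νA.prod νK) := lintegral_mono_set hTsub
      _ = 0 := h0
  have hpos : 0 < ENNReal.ofReal (G (a₀, k₀) / 2) * (νA.prod νK) T :=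
    ENNReal.mul_pos (ENNReal.ofReal_pos.2 (half_pos hG0)).ne' hTpos.ne'
  exact hpos.ne' (nonpos_iff_eq_zero.1 hle)

end Positivity

/-! ### Base points: from one non-zero value of `W` to the hypotheses above -/

section BasePoint

variable {n : ℕ} {K : Type} [Field K] [NumberField K]

/-- **A torus base point from a non-zero value.** If `‖W(u g)‖ = ‖W(g)‖` for all `u ∈ N_n(𝔸_K)` (as
for a `ψ`-Whittaker function, `W(u g) = ψ(u) W(g)`) and `W(g₀) ≠ 0`, then `W(diag(a) k) ≠ 0` for some
torus coordinate `a ∈ (𝔸_Kˣ)ⁿ` and some `k ∈ K = K_∞ GL_n(𝒪̂_K)`: write `g₀ = b k` by the Iwasawa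
decomposition (`iwasawaDecomposition_gl_adelic_holds`) and `b = u · diag(a)`
(`exists_upperUnitriangular_mul_glDiagonal`). [folklore] -/
theorem exists_torusPoint_apply_ne_zero {W : GL (Fin n) (AdeleRing (𝓞 K) K) → ℂ}
    (hWN : ∀ u ∈ upperUnitriangular (Fin n) (AdeleRing (𝓞 K) K), ∀ g, ‖W (u * g)‖ = ‖W g‖)
    {g₀ : GL (Fin n) (AdeleRing (𝓞 K) K)} (hg₀ : W g₀ ≠ 0) :
    ∃ (a : Fin n → ideleGroup K) (k : ↥(maximalCompactAdelic n K)), W (torusPoint n K (a, k)) ≠ 0 := by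
  obtain ⟨b, hb, k, hk, hbk⟩ := exists_parabolicAdelic_mul_maximalCompactAdelic n K
    (iwasawaDecomposition_gl_adelic_holds n K) monotone_id (g₀ : (AdelicGroupData.gl n K).Adelic)
  have hb' : b ∈ standardParabolicGL (AdeleRing (𝓞 K) K) (id : Fin n → Fin n) := hb
  obtain ⟨u, hu, d, -, hbd⟩ := exists_upperUnitriangular_mul_glDiagonal
    ((mem_standardParabolicGL_iff _ _).1 hb')
  refine ⟨d, ⟨k, hk⟩, fun h0 => hg₀ ?_⟩
  have e : g₀ = u * torusPoint n K (d, ⟨k, hk⟩) := by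
    change g₀ = u * (glDiagonal n (AdeleRing (𝓞 K) K) d * (show GL (Fin n) (AdeleRing (𝓞 K) K) from k))
    rw [← mul_assoc, ← hbd]
    exact hbk
  have h : ‖W g₀‖ = 0 := by rw [e, hWN u hu, h0, norm_zero]
  exact norm_eq_zero.1 h

/-- The set of finite places at which some entry of a torus element is not a unit is finite.
[folklore] -/
theorem finite_setOf_exists_valued_ne_one (a : Fin n → ideleGroup K) :
    {w : HeightOneSpectrum (𝓞 K) | ∃ i, Valued.v (((a i : ideleGroup K) : AdeleRing (𝓞 K) K).2 w) ≠ 1}.Finite := by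
  have h : {w : HeightOneSpectrum (𝓞 K) | ∃ i, Valued.v (((a i : ideleGroup K) : AdeleRing (𝓞 K) K).2 w) ≠ 1} =
      ⋃ i, {w | Valued.v (((a i : ideleGroup K) : AdeleRing (𝓞 K) K).2 w) ≠ 1} := by
    ext w
    simp only [Set.mem_setOf_eq, Set.mem_iUnion]
  rw [h]
  exact Set.finite_iUnion fun i => finite_setOf_valued_snd_ne_one (a i)

/-- A torus element lies in the unit box of the set of places where all its entries are units (by
definition); together with `finite_setOf_exists_valued_ne_one` this puts the remaining places into
the exceptional finite set. [folklore] -/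
theorem mem_unitBox_setOf_forall (a : Fin n → ideleGroup K) :
    a ∈ unitBox {w : HeightOneSpectrum (𝓞 K) | ∀ i, Valued.v (((a i : ideleGroup K) : AdeleRing (𝓞 K) K).2 w) = 1} :=
  fun _ hw i => hw i

/-- **Clearing the denominators of an idele by a global integer**: for every idele `x` there is a
non-zero `d ∈ 𝓞 K` with `d x` integral at every finite place (`FiniteAdeleRing.exists_ne_zero_forall_mul_mem`
on the finite part). In the assembly `d`, a central element of `GL_n(K)`, rescales the last torus
coordinate of the base point without changing `W` (`W(ξ g) = W(g)` for `ξ ∈ Z(K)`). [folklore] -/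
theorem exists_ne_zero_valued_algebraMap_mul_le_one (x : ideleGroup K) :
    ∃ d : 𝓞 K, d ≠ 0 ∧ ∀ w : HeightOneSpectrum (𝓞 K),
      Valued.v ((algebraMap K (AdeleRing (𝓞 K) K) (d : K) * (x : AdeleRing (𝓞 K) K)).2 w) ≤ 1 := by
  obtain ⟨d, hd, h⟩ := FiniteAdeleRing.exists_ne_zero_forall_mul_mem (𝓞 K) K ((x : AdeleRing (𝓞 K) K).2)
  refine ⟨d, hd, fun w => ?_⟩
  have e : (algebraMap K (AdeleRing (𝓞 K) K) (d : K) * (x : AdeleRing (𝓞 K) K)).2 =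
      algebraMap (𝓞 K) (FiniteAdeleRing (𝓞 K) K) d * (x : AdeleRing (𝓞 K) K).2 := by
    rw [IsScalarTower.algebraMap_apply (𝓞 K) K (FiniteAdeleRing (𝓞 K) K)]
    rfl
  rw [e]
  exact (HeightOneSpectrum.mem_adicCompletionIntegers _ _ _).1 (h w)

end BasePoint

end Literature.NumberTheory.Automorphic
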